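import Mathlib
import Summits.Ventures.HodgeRepro2.Tier7.Line3.DensityTransfer

/-!
# Tier7/Line3/ArchFiniteCompat — the rational regular `γ₀` under all local conditions at once

Filer: t7-L1-p3 (gen 4, prover-pub-hodge-repro2-t7-L1-p3-g4-0), TARGET line STATUS l. 15227. Lane: SUPPORT for
Line 3's version-(ii) chain (L3-ARGUMENT.md v13 §2f, the `a_γ₀ ≠ 0` row, right-hand column, last clause: «and that
the open conditions at the finite places (γ₀ in the support, the κ-congruence class) are compatible with the
archimedean ones»); NOT a line, NOT a device.

WHAT IT SUPPLIES. Lemma WA′ gives `Γ = U(W_A)(F)` dense in `∏_{v∈T} U(W_A)(F_v)` (Tier7/Line3/DensityTransfer,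
p676334, modulo its displayed inputs). The rational regular `γ₀` of §2g (5) must satisfy, at the same time, the
archimedean conditions of rows 680 / 681 / 695 («regular and non-vanishing»: `Φ_q(γ₀) ≠ 0` and `κ(γ₀) ≠ 1`) and the
finite-place conditions (`γ₀` in the support of `f_fin`, the κ-congruence class `κ(γ₀) ∈ κ₀ + M⁻¹𝓞_K`). Every one of
these is a NON-EMPTY OPEN condition at its place, and a dense set meets every non-empty open box:

* (C1) `exists_mem_dense_pi_open` — `Finite ι`, `S` dense in `∏ X v`, `U v` open and non-empty at every `v`
  ⇒ `∃ s ∈ S, ∀ v, s v ∈ U v`; `exists_mem_dense_pi_open_of_subset` allows the conditions to be given as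
  supersets of open non-empty sets.
* (C2) the archimedean × finite split `exists_mem_dense_prod_open` (`Dense S ⊆ A × B`, `U ⊆ A`, `V ⊆ B` open
  non-empty ⇒ `∃ s ∈ S, s.1 ∈ U ∧ s.2 ∈ V`) and `exists_mem_dense_prod_ne_zero_notMem_mem` — at `A` exactly the
  row-680 condition (`F` continuous, `∃ F ≠ 0`, `Z` closed with empty interior), at `B` any non-empty open `V`
  ⇒ `∃ s ∈ S, F s.1 ≠ 0 ∧ s.1 ∉ Z ∧ s.2 ∈ V`; `isOpen_ne_zero_diff` / `nonempty_ne_zero_diff` say that the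
  row-680 condition IS a non-empty open set, and `exists_mem_dense_pi_ne_zero_notMem` is its all-places form
  (a row-680 condition at EVERY place of a finite family — the three archimedean places of `T` and, with
  `Z = ∅`, `F = 1` on the support, the finite ones).
* (C3) `isOpen_preimage_vadd_coset` — the κ-congruence condition `κ(γ) ∈ κ₀ + M` (`M` an OPEN additive subgroup,
  `κ` continuous) is an open condition on `γ`; `isOpen_preimage_sub_mem` is the same written `κ γ - κ₀ ∈ M`.
* (C4) `exists_mem_of_approximations` — THE COMPOSITE with DensityTransfer: the four displayed inputs of Lemma WA′
  (SA / WA / H90 / the det sections) and non-empty open conditions `U v` at every place of `T`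
  ⇒ `∃ γ ∈ Γ, ∀ v, γ v ∈ U v`.

SCOPE (crit-2 l. 15259, accepted): (C1)–(C4) quantify over the FINITE set `T` and say nothing about the places
`v ∉ T`, where the rational `γ₀` still has to lie in (a double coset meeting) `K_v` for its unramified weight to
be non-zero — «compatibility at the places of `T` only». The v2 append carries the kernel half of the route
through `SU` (strong approximation holds for `SU(W_A)`, GH 2.5.6, in the RESTRICTED product):

* (C5) `isOpen_restrictedProduct_box` / `nonempty_restrictedProduct_box` / `exists_mem_dense_restrictedProduct_box`
  — a dense subset of Mathlib's restricted product `Πʳ i, [R i, A i]` (`A i` open, non-empty) contains an element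
  with `γ i ∈ U i` for the finitely many `i ∈ T` AND `γ i ∈ A i` for EVERY `i ∉ T` (the box is open in the
  restricted-product topology); with `Γ = SU(W_A)(F)`, `A_v = K_v`, this controls `γ₀` outside `T` for free.
* (C6) `exists_mem_inter_of_mul_invariant` / `mem_inter_of_mul_invariant` — if `G = Z · H` and a non-empty
  condition `V` is invariant under left translation by `Z`, then `V` meets `H`: the archimedean and `T`-conditions
  (`Φ_q ≠ 0`, `κ ≠ 1` are `Z`-invariant: `Φ_q(zγ) = ω(z) Φ_q(γ)`, `κ(zγ) = κ(γ)`) can be met inside `SU`.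
  Whether the line takes `γ₀ ∈ SU(W_A)(F)` is the memo's call (v14); nothing here decides it.

NOT in this file: the printed inputs of Lemma WA′, the non-emptiness of the archimedean conditions in the MODEL
(rows 678 / 680 / 681 / 694 / 695, p1), the dictionary model ↔ `U(W_A)(F_v)`, anything about `X`; nothing about
the step (P) is claimed.

§8(d) (uses an L-value-free non-vanishing device): NO — «a dense set meets every non-empty open set».
-/

namespace Summit.Ventures.HodgeRepro2.Tier7.Line3.ArchFiniteCompat

open Set Topology Function
open scoped Pointwise

section Box

variable {ι : Type*} {X : ι → Type*} [∀ v, TopologicalSpace (X v)]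

/-- (C1) A dense subset of a FINITE product meets every box of non-empty open sets: the local
conditions at the places of `T` are simultaneously satisfiable by an element of the dense set. -/
theorem exists_mem_dense_pi_open [Finite ι] {S : Set (∀ v, X v)} (hS : Dense S) {U : ∀ v, Set (X v)}
    (hU : ∀ v, IsOpen (U v)) (hUne : ∀ v, (U v).Nonempty) : ∃ s ∈ S, ∀ v, s v ∈ U v := by
  obtain ⟨s, hsS, hs⟩ := hS.exists_mem_open (isOpen_set_pi finite_univ fun v _ => hU v)
    (univ_pi_nonempty_iff.mpr hUne)
  exact ⟨s, hsS, fun v => hs v (mem_univ v)⟩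

/-- (C1′) The same when each condition `C v` merely CONTAINS a non-empty open set. -/
theorem exists_mem_dense_pi_open_of_subset [Finite ι] {S : Set (∀ v, X v)} (hS : Dense S)
    {C : ∀ v, Set (X v)} (hC : ∀ v, ∃ U : Set (X v), IsOpen U ∧ U.Nonempty ∧ U ⊆ C v) :
    ∃ s ∈ S, ∀ v, s v ∈ C v := by
  choose U hUo hUne hUC using hC
  obtain ⟨s, hsS, hs⟩ := exists_mem_dense_pi_open hS hUo hUne
  exact ⟨s, hsS, fun v => hUC v (hs v)⟩

end Box

section Regular

variable {A : Type*} [TopologicalSpace A] {W : Type*} [TopologicalSpace W] [T1Space W] [Zero W]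

/-- The row-680 condition «`F ≠ 0` and outside the closed set `Z`» is open. -/
theorem isOpen_ne_zero_diff {F : A → W} (hF : Continuous F) {Z : Set A} (hZ : IsClosed Z) :
    IsOpen ({x | F x ≠ 0} \ Z) :=
  (isOpen_compl_singleton.preimage hF).inter hZ.isOpen_compl

/-- The row-680 condition is non-empty when `F` is not identically zero and `Z` has empty
interior (else the non-empty open set `{F ≠ 0}` would lie in `interior Z`). -/
theorem nonempty_ne_zero_diff {F : A → W} (hF : Continuous F) (hne : ∃ x, F x ≠ 0) {Z : Set A}
    (hZ : interior Z = ∅) : ({x | F x ≠ 0} \ Z).Nonempty := by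
  by_contra h
  rw [not_nonempty_iff_eq_empty, sdiff_eq_empty] at h
  obtain ⟨x, hx⟩ := hne
  have : x ∈ interior Z := interior_maximal h (isOpen_compl_singleton.preimage hF) hx
  rw [hZ] at this
  exact this

/-- (C2′′) All-places form of the row-680 condition: a dense subset of a finite product meets the
box of «`F v ≠ 0` and not in `Z v`» conditions, one at every place. -/
theorem exists_mem_dense_pi_ne_zero_notMem {ι : Type*} [Finite ι] {X : ι → Type*}
    [∀ v, TopologicalSpace (X v)] {S : Set (∀ v, X v)} (hS : Dense S) {F : ∀ v, X v → W}
    (hF : ∀ v, Continuous (F v)) (hne : ∀ v, ∃ x, F v x ≠ 0) {Z : ∀ v, Set (X v)}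
    (hZc : ∀ v, IsClosed (Z v)) (hZ : ∀ v, interior (Z v) = ∅) :
    ∃ s ∈ S, ∀ v, F v (s v) ≠ 0 ∧ s v ∉ Z v := by
  obtain ⟨s, hsS, hs⟩ := exists_mem_dense_pi_open hS (U := fun v => {x | F v x ≠ 0} \ Z v)
    (fun v => isOpen_ne_zero_diff (hF v) (hZc v)) (fun v => nonempty_ne_zero_diff (hF v) (hne v) (hZ v))
  exact ⟨s, hsS, fun v => hs v⟩

end Regular

section Split

variable {A B : Type*} [TopologicalSpace A] [TopologicalSpace B]

/-- (C2) Archimedean × finite split: a dense subset of `A × B` meets `U ×ˢ V` for non-empty open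
`U ⊆ A` (the archimedean condition) and `V ⊆ B` (the finite-place condition). -/
theorem exists_mem_dense_prod_open {S : Set (A × B)} (hS : Dense S) {U : Set A} (hU : IsOpen U)
    (hUne : U.Nonempty) {V : Set B} (hV : IsOpen V) (hVne : V.Nonempty) :
    ∃ s ∈ S, s.1 ∈ U ∧ s.2 ∈ V := by
  obtain ⟨s, hsS, hs⟩ := hS.exists_mem_open (hU.prod hV) (hUne.prod hVne)
  exact ⟨s, hsS, hs.1, hs.2⟩

/-- (C2′) Row 680's archimedean condition (`F` continuous, not identically zero, `Z` closed with
empty interior) together with ANY non-empty open finite-place condition `V`: a dense `S ⊆ A × B`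
contains a point with `F s.1 ≠ 0`, `s.1 ∉ Z` and `s.2 ∈ V`. (The finite-place slot rows 680 / 681
do not carry.) -/
theorem exists_mem_dense_prod_ne_zero_notMem_mem {W : Type*} [TopologicalSpace W] [T1Space W]
    [Zero W] {S : Set (A × B)} (hS : Dense S) {F : A → W} (hF : Continuous F) (hne : ∃ x, F x ≠ 0)
    {Z : Set A} (hZc : IsClosed Z) (hZ : interior Z = ∅) {V : Set B} (hV : IsOpen V)
    (hVne : V.Nonempty) : ∃ s ∈ S, F s.1 ≠ 0 ∧ s.1 ∉ Z ∧ s.2 ∈ V := by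
  obtain ⟨s, hsS, hs1, hs2⟩ := exists_mem_dense_prod_open hS (isOpen_ne_zero_diff hF hZc)
    (nonempty_ne_zero_diff hF hne hZ) hV hVne
  exact ⟨s, hsS, hs1.1, hs1.2, hs2⟩

end Split

section Congruence

variable {G E : Type*} [TopologicalSpace G] [TopologicalSpace E] [AddCommGroup E]
  [IsTopologicalAddGroup E]

/-- (C3) The κ-congruence condition `κ γ - κ₀ ∈ M` is open in `γ` for a continuous `κ` and an OPEN
additive subgroup `M` (a coset of an open subgroup is open: it is the preimage of `M` under the
homeomorphism `x ↦ x - κ₀`). -/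
theorem isOpen_preimage_sub_mem {κ : G → E} (hκ : Continuous κ) (κ₀ : E) {M : AddSubgroup E}
    (hM : IsOpen (M : Set E)) : IsOpen {γ | κ γ - κ₀ ∈ M} :=
  hM.preimage ((continuous_id.sub continuous_const).comp hκ)

/-- (C3′) The same written with the coset `κ₀ +ᵥ M`: `{γ | κ γ ∈ κ₀ +ᵥ (M : Set E)}` is open. -/
theorem isOpen_preimage_vadd_coset {κ : G → E} (hκ : Continuous κ) (κ₀ : E) {M : AddSubgroup E}
    (hM : IsOpen (M : Set E)) : IsOpen {γ | κ γ ∈ κ₀ +ᵥ (M : Set E)} := by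
  have h : {γ | κ γ ∈ κ₀ +ᵥ (M : Set E)} = {γ | κ γ - κ₀ ∈ M} := by
    ext γ
    simp only [mem_setOf_eq]
    constructor
    · intro hγ
      obtain ⟨m, hm, hmγ⟩ := Set.mem_vadd_set.mp hγ
      rw [vadd_eq_add] at hmγ
      rw [← hmγ]
      simpa using hm
    · intro hm
      exact Set.mem_vadd_set.mpr ⟨κ γ - κ₀, hm, by rw [vadd_eq_add]; abel⟩
  rw [h]
  exact isOpen_preimage_sub_mem hκ κ₀ hM

end Congruence

section Composite

open DensityTransfer

variable {ι : Type*} [Finite ι] {G N E : ι → Type*} [∀ v, Group (G v)] [∀ v, TopologicalSpace (G v)]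
  [∀ v, IsTopologicalGroup (G v)] [∀ v, Group (N v)] [∀ v, TopologicalSpace (N v)]
  [∀ v, TopologicalSpace (E v)]

/-- (C4) THE COMPOSITE with Lemma WA′ (`DensityTransfer.dense_of_approximations`): under the four
displayed inputs (SA) strong approximation at `T` for `ker det`, (WA) the field dense at `T`, (H90) the
local Hilbert-90 surjections matched by global elements of `Γ`, and the continuous det sections,
every family of non-empty open local conditions `U v` is met by some `γ ∈ Γ`. -/
theorem exists_mem_of_approximations (det : ∀ v, G v →* N v) (q : ∀ v, E v → N v)
    (hq : ∀ v, Continuous (q v)) (hqs : ∀ v, Surjective (q v)) (s : ∀ v, N v → G v)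
    (hs : ∀ v, Continuous (s v)) (hdet_s : ∀ v n, det v (s v n) = n) (Γ : Subgroup (∀ v, G v))
    (hSA : ∀ x : ∀ v, G v, (∀ v, det v (x v) = 1) → x ∈ closure (Γ : Set (∀ v, G v)))
    {S : Set (∀ v, E v)} (hWA : Dense S)
    (hH90 : ∀ z ∈ S, ∃ γ ∈ Γ, ∀ v, det v (γ v) = q v (z v)) {U : ∀ v, Set (G v)}
    (hU : ∀ v, IsOpen (U v)) (hUne : ∀ v, (U v).Nonempty) : ∃ γ ∈ Γ, ∀ v, γ v ∈ U v :=
  exists_mem_dense_pi_open (dense_of_approximations det q hq hqs s hs hdet_s Γ hSA hWA hH90) hU hUne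

end Composite

section RestrictedBox

open scoped RestrictedProduct
open Filter

variable {ι : Type*} {R : ι → Type*} {A : (i : ι) → Set (R i)} [∀ i, TopologicalSpace (R i)]

/-- (C5a) The restricted-product BOX «`x i ∈ U i` for the finitely many `i ∈ T`, `x i ∈ A i` for
`i ∉ T`» is OPEN in Mathlib's restricted product `Πʳ i, [R i, A i]` when every `A i` is open
(finitely many open coordinate conditions, and `RestrictedProduct.isOpen_forall_imp_mem`). -/
theorem isOpen_restrictedProduct_box (hA : ∀ i, IsOpen (A i)) {T : Set ι} (hT : T.Finite)
    {U : ∀ i, Set (R i)} (hU : ∀ i ∈ T, IsOpen (U i)) :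
    IsOpen {x : Πʳ i, [R i, A i] | (∀ i ∈ T, x i ∈ U i) ∧ ∀ i, i ∉ T → x i ∈ A i} := by
  have h1 : IsOpen {x : Πʳ i, [R i, A i] | ∀ i ∈ T, x i ∈ U i} := by
    have : {x : Πʳ i, [R i, A i] | ∀ i ∈ T, x i ∈ U i} =
        ⋂ i ∈ T, (fun x : Πʳ i, [R i, A i] => x i) ⁻¹' U i := by
      ext x
      simp only [Set.mem_setOf_eq, Set.mem_iInter, Set.mem_preimage]
    rw [this]
    exact hT.isOpen_biInter fun i hi => (hU i hi).preimage (RestrictedProduct.continuous_eval i)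
  have h2 : IsOpen {x : Πʳ i, [R i, A i] | ∀ i, i ∉ T → x i ∈ A i} :=
    RestrictedProduct.isOpen_forall_imp_mem hA (p := fun i => i ∉ T)
  exact h1.inter h2

omit [∀ i, TopologicalSpace (R i)] in
/-- (C5b) The box is NON-EMPTY as soon as every `U i` (`i ∈ T`) and every `A i` is. -/
theorem nonempty_restrictedProduct_box (hA : ∀ i, (A i).Nonempty) {T : Set ι} (hT : T.Finite)
    {U : ∀ i, Set (R i)} (hU : ∀ i ∈ T, (U i).Nonempty) :
    {x : Πʳ i, [R i, A i] | (∀ i ∈ T, x i ∈ U i) ∧ ∀ i, i ∉ T → x i ∈ A i}.Nonempty := by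
  classical
  refine ⟨RestrictedProduct.mk (fun i => if h : i ∈ T then (hU i h).some else (hA i).some) ?_, ?_, ?_⟩
  · rw [Filter.eventually_cofinite]
    refine hT.subset fun i hi => ?_
    by_contra hiT
    apply hi
    simp only [hiT, dif_neg, not_false_eq_true]
    exact (hA i).some_mem
  · intro i hi
    simp only [RestrictedProduct.mk_apply, hi, dif_pos]
    exact (hU i hi).some_mem
  · intro i hi
    simp only [RestrictedProduct.mk_apply, hi, dif_neg, not_false_eq_true]
    exact (hA i).some_mem

/-- (C5) THE RESTRICTED-PRODUCT BOX (the strong-approximation route for the places outside `T`,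
crit-2 l. 15259): a DENSE subset `Γ` of the restricted product `Πʳ i, [R i, A i]` (every `A i` open
and non-empty — `SU(W_A)(F)` in `SU(W_A)(𝔸^w)` with the hyperspecial `K_v`, GH 2.5.6) contains an
element lying in prescribed non-empty open sets `U i` at the finitely many `i ∈ T` AND in `A i`
(«in `K_v`») at EVERY `i ∉ T`. -/
theorem exists_mem_dense_restrictedProduct_box (hAo : ∀ i, IsOpen (A i))
    (hAne : ∀ i, (A i).Nonempty) {Γ : Set (Πʳ i, [R i, A i])} (hΓ : Dense Γ) {T : Set ι}
    (hT : T.Finite) {U : ∀ i, Set (R i)} (hU : ∀ i ∈ T, IsOpen (U i))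
    (hUne : ∀ i ∈ T, (U i).Nonempty) :
    ∃ γ ∈ Γ, (∀ i ∈ T, γ i ∈ U i) ∧ ∀ i, i ∉ T → γ i ∈ A i := by
  obtain ⟨γ, hγΓ, hγ⟩ := hΓ.exists_mem_open (isOpen_restrictedProduct_box hAo hT hU)
    (nonempty_restrictedProduct_box hAne hT hUne)
  exact ⟨γ, hγΓ, hγ⟩

end RestrictedBox

section CentreInvariant

variable {G : Type*} [Group G]

/-- (C6) CENTRE-INVARIANT CONDITIONS ARE MET INSIDE `SU`: if every `g ∈ G` factors as `g = z * h` with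
`z ∈ Z`, `h ∈ H` (`U(W_A)(F_v) = Z · SU(W_A)(F_v)`) and the non-empty condition `V` is invariant under
left translation by `Z` (`Φ_q(zγ) = ω(z) Φ_q(γ)`, `κ(zγ) = κ(γ)`), then `V` meets `H`:
`v = z * h ⇒ h = z⁻¹ * v ∈ V ∩ H`. -/
theorem exists_mem_inter_of_mul_invariant (Z H : Subgroup G)
    (hZH : ∀ g : G, ∃ z ∈ Z, ∃ h ∈ H, g = z * h) {V : Set G} (hV : V.Nonempty)
    (hinv : ∀ z ∈ Z, ∀ v ∈ V, z * v ∈ V) : (V ∩ (H : Set G)).Nonempty := by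
  obtain ⟨v, hv⟩ := hV
  obtain ⟨z, hz, h, hh, rfl⟩ := hZH v
  refine ⟨h, ?_, hh⟩
  have := hinv z⁻¹ (Z.inv_mem hz) (z * h) hv
  rwa [inv_mul_cancel_left] at this

/-- (C6′) The same for a condition given as a set `V` with `V.Nonempty` replaced by a witness. -/
theorem mem_inter_of_mul_invariant (Z H : Subgroup G)
    (hZH : ∀ g : G, ∃ z ∈ Z, ∃ h ∈ H, g = z * h) {V : Set G} {v : G} (hv : v ∈ V)
    (hinv : ∀ z ∈ Z, ∀ v ∈ V, z * v ∈ V) : ∃ h ∈ H, h ∈ V := by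
  obtain ⟨h, hhV, hhH⟩ := exists_mem_inter_of_mul_invariant Z H hZH ⟨v, hv⟩ hinv
  exact ⟨h, hhH, hhV⟩

end CentreInvariant

end Summit.Ventures.HodgeRepro2.Tier7.Line3.ArchFiniteCompat
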